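import Mathlib
import HarnessLib
import Summits.Ventures.LatticeQCDFlow.Scoring.GreenKuboCrossCovariance
import Summits.Ventures.LatticeQCDFlow.Scoring.DoeblinPowerGeometricEnvelope
import Summits.Ventures.LatticeQCDFlow.Scoring.IndependentJointLimit
import Summits.Ventures.LatticeQCDFlow.Exactness.NCMCGeneralSpaceDoeblinPowerCLT

/-!
# THE BIVARIATE MARKOV-CHAIN CLT under a Doeblin power, from any initial law:
# `((√n)⁻¹ Σ_{t<n} f̄(X_t), (√n)⁻¹ Σ_{t<n} ḡ(X_t)) ⇒ N(0, Σ)`, `Σ = [[σ²_f, σ_{fg}], [σ_{fg}, σ²_g]]`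

HONEST FRAMING: exact (Metropolis-corrected) sampling algorithms for lattice gauge theory;
figures of merit are autocorrelation/cost numbers at stated couplings and volumes; no
continuum-physics claim.

Venture `LatticeQCDFlow` (cell pub-lqcd), topic `Scoring`; FANOUT row 8 (`s0-cpn-nemc`, GEN-22).
NEW WORK of the cell, not a published result; no definition is introduced; nothing is cited as a
fact.  Row 13's Markov-chain CLT under a Doeblin power `(nHit κ m)(z, ·) ≥ ε ν`
(`Exactness.GeneralNCMC.tendstoInDistribution_timeAverage_of_nHit`: `(√n)⁻¹ Σ_{t<n} h̄(X_t) ⇒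
N(0, σ²_h)` from ANY initial law, for every bounded measurable `h`) is one-dimensional.  Applied to
`h = u f + v g` and combined with the bilinearity of the Green–Kubo variance
(`Scoring/GreenKuboCrossCovariance.greenKubo_lincomb_eq_of_envelope`:
`σ²_{uf+vg} = u² σ²_f + 2uv σ_{fg} + v² σ²_g`) it gives the CLT of every fixed linear combination
with the variance written as the quadratic form of `Σ = [[σ²_f, σ_{fg}], [σ_{fg}, σ²_g]]`; the
Cramér–Wold device (`Scoring/CramerWoldDevice.lean`, read in `WithLp 2 (ℝ × ℝ)` as in
`Scoring/IndependentJointLimit.lean`) then gives the JOINT convergence of the pair of scaled sums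
to any pair `(Z₁, Z₂)` whose linear combinations `u Z₁ + v Z₂` are `N(0, u² σ²_f + 2uv σ_{fg} + v² σ²_g)`;
and such a pair EXISTS on `(ℝ², N(0,1) ⊗ N(0,1))` by the two-dimensional Cholesky factorisation,
because `Σ` is positive semidefinite (`σ_{fg}² ≤ σ²_f σ²_g`,
`Scoring/GreenKuboCrossCovariance.greenKuboCross_sq_le_of_envelope`).  This is the input of every
delta-method error bar for a function of two chain averages (`Scoring/RatioDeltaMethod.lean`).
Printed counterparts NAMED ONLY: the multivariate Markov-chain CLT (Meyn–Tweedie 1993 §17;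
Jones 2004), nothing cited as a fact.

## Content (`P_{μ₀}` the path law; `f̄ = f − πf`; `Q(u,v) = u² σ²_f + 2uv σ_{fg} + v² σ²_g`)

* `exists_gaussianPair` — `0 ≤ s₁`, `0 ≤ s₂`, `c² ≤ s₁ s₂` ⇒ measurable `Z₁, Z₂` on
  `(ℝ × ℝ, N(0,1) ⊗ N(0,1))` with `u Z₁ + v Z₂ ~ N(0, u² s₁ + 2uv c + v² s₂)` for all `u, v`;
* **`chain_lincomb_clt_of_nHit`** — `(√n)⁻¹ Σ_{t<n} (u f̄ + v ḡ)(X_t) ⇒ Y` for any `Y ~ N(0, Q(u,v))`;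
* **`chain_bivariate_clt_of_nHit`** — for any a.e.-measurable `Z₁, Z₂` with
  `u Z₁ + v Z₂ ~ N(0, Q(u,v))` (all `u, v`): `((√n)⁻¹ Σ f̄(X_t), (√n)⁻¹ Σ ḡ(X_t)) ⇒ (Z₁, Z₂)` in `ℝ × ℝ`;
* **`chain_bivariate_clt_exists_of_nHit`** — the Gaussian pair exists, so the joint CLT is not
  vacuous: `∃ Z₁ Z₂` on `(ℝ², N(0,1)²)` with those laws and the joint convergence.

NOT CLAIMED: more than two observables (iterate); a rate; unbounded observables; any number.
-/

noncomputable section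

namespace Summit.Ventures.LatticeQCDFlow.Scoring

open MeasureTheory ProbabilityTheory Filter Finset Preorder WithLp
open scoped ENNReal Topology RealInnerProductSpace

/-! ### A Gaussian pair with a prescribed (positive semidefinite) covariance -/

section GaussianPair

/-- **Cholesky in dimension two.**  For `0 ≤ s₁`, `0 ≤ s₂`, `c² ≤ s₁ s₂` there are measurable
`Z₁, Z₂ : ℝ × ℝ → ℝ` such that under `N(0,1) ⊗ N(0,1)` every combination `u Z₁ + v Z₂` is
`N(0, u² s₁ + 2uv c + v² s₂)` (`Z₁ = α ω₁`, `Z₂ = β ω₁ + γ ω₂` with `α = √s₁`, `β = c/α`, `γ = √(s₂ − β²)`). -/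
theorem exists_gaussianPair {s₁ s₂ c : ℝ} (h₁ : 0 ≤ s₁) (h₂ : 0 ≤ s₂) (hc : c ^ 2 ≤ s₁ * s₂) :
    ∃ Z₁ Z₂ : ℝ × ℝ → ℝ, Measurable Z₁ ∧ Measurable Z₂ ∧ ∀ u v : ℝ,
      HasLaw (fun ω => u * Z₁ ω + v * Z₂ ω)
        (gaussianReal 0 (u ^ 2 * s₁ + 2 * (u * v) * c + v ^ 2 * s₂).toNNReal)
        ((gaussianReal 0 1).prod (gaussianReal 0 1)) := by
  set P : Measure (ℝ × ℝ) := (gaussianReal 0 1).prod (gaussianReal 0 1) with hP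
  set α : ℝ := Real.sqrt s₁ with hα
  set β : ℝ := c / α with hβ
  have hα2 : α ^ 2 = s₁ := Real.sq_sqrt h₁
  have hαβ : α * β = c := by
    rcases eq_or_lt_of_le h₁ with h0 | hpos
    · have hc2 : c ^ 2 = 0 := le_antisymm (by rw [← h0, zero_mul] at hc; exact hc) (sq_nonneg c)
      have hα0 : α = 0 := by rw [hα, ← h0, Real.sqrt_zero]
      rw [hα0, zero_mul]
      exact (pow_eq_zero_iff two_ne_zero).1 hc2 |>.symm
    · have hαpos : 0 < α := Real.sqrt_pos.2 hpos
      rw [hβ]; field_simp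
  have hβ2 : β ^ 2 ≤ s₂ := by
    rcases eq_or_lt_of_le h₁ with h0 | hpos
    · have hα0 : α = 0 := by rw [hα, ← h0, Real.sqrt_zero]
      rw [hβ, hα0, div_zero]; simpa using h₂
    · have e : β ^ 2 = c ^ 2 / s₁ := by rw [hβ, div_pow, hα2]
      rw [e, div_le_iff₀ hpos]; linarith [hc]
  set γ : ℝ := Real.sqrt (s₂ - β ^ 2) with hγ
  have hγ2 : γ ^ 2 = s₂ - β ^ 2 := Real.sq_sqrt (sub_nonneg.2 hβ2)
  refine ⟨fun ω => α * ω.1, fun ω => β * ω.1 + γ * ω.2, measurable_fst.const_mul _,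
    (measurable_fst.const_mul _).add (measurable_snd.const_mul _), fun u v => ?_⟩
  -- the two independent standard Gaussian coordinates, scaled
  have h1 : HasLaw (fun ω : ℝ × ℝ => ω.1) (gaussianReal 0 1) P :=
    ⟨measurable_fst.aemeasurable, by rw [hP, Measure.map_fst_prod, measure_univ, one_smul]⟩
  have h2 : HasLaw (fun ω : ℝ × ℝ => ω.2) (gaussianReal 0 1) P :=
    ⟨measurable_snd.aemeasurable, by rw [hP, Measure.map_snd_prod, measure_univ, one_smul]⟩
  have hX := gaussianReal_const_mul h1 (u * α + v * β)
  have hY := gaussianReal_const_mul h2 (v * γ)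
  rw [mul_zero] at hX hY
  have hind : IndepFun (fun ω : ℝ × ℝ => (u * α + v * β) * ω.1) (fun ω => (v * γ) * ω.2) P :=
    indepFun_prod (measurable_const_mul _) (measurable_const_mul _)
  have hsum := gaussianReal_add_gaussianReal_of_indepFun hind hX.map_eq hY.map_eq
  have hfun : (fun ω : ℝ × ℝ => u * (α * ω.1) + v * (β * ω.1 + γ * ω.2))
      = (fun ω : ℝ × ℝ => (u * α + v * β) * ω.1) + (fun ω => (v * γ) * ω.2) := by
    funext ω; simp only [Pi.add_apply]; ring
  have hid : (u * α + v * β) ^ 2 + (v * γ) ^ 2 = u ^ 2 * s₁ + 2 * (u * v) * c + v ^ 2 * s₂ := by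
    have e2 : s₂ = β ^ 2 + γ ^ 2 := by rw [hγ2]; ring
    rw [← hα2, ← hαβ, e2]; ring
  have hnn : 0 ≤ u ^ 2 * s₁ + 2 * (u * v) * c + v ^ 2 * s₂ := by rw [← hid]; positivity
  refine ⟨by fun_prop, ?_⟩
  rw [hfun, hsum, add_zero]
  congr 1
  apply NNReal.coe_injective
  simp only [NNReal.coe_add, NNReal.coe_mk, mul_one, Real.coe_toNNReal _ hnn]
  exact hid

end GaussianPair

variable {Ω : Type*} [MeasurableSpace Ω]
  {κ : Kernel Ω Ω} [IsMarkovKernel κ] {ν : Measure Ω} [IsProbabilityMeasure ν] {ε : ℝ≥0∞} {m : ℕ}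

/-! ### The CLT of a fixed linear combination, variance as the quadratic form -/

section Lincomb

/-- **CLT OF A LINEAR COMBINATION, FROM ANY INITIAL LAW.**  `π` invariant, `(nHit κ m)(z,·) ≥ ε ν`
(`0 < ε ≤ 1`, `0 < m`), `|f| ≤ C_f`, `|g| ≤ C_g` measurable, `u, v` reals; for any
`Y ~ N(0, u² σ²_f + 2uv σ_{fg} + v² σ²_g)`:
`(√n)⁻¹ Σ_{t<n} (u (f(x_t) − πf) + v (g(x_t) − πg)) ⇒ Y` under `P_{μ₀}`. -/
theorem chain_lincomb_clt_of_nHit {π : Measure Ω} [IsProbabilityMeasure π]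
    (hπ : Kernel.Invariant κ π) (hmin : ∀ z, ε • ν ≤ Exactness.nHit κ m z) (hε0 : 0 < ε)
    (hε1 : ε ≤ 1) (hm : 0 < m)
    {f g : Ω → ℝ} (hf : Measurable f) (hg : Measurable g) {Cf Cg : ℝ} (hCf : ∀ x, |f x| ≤ Cf)
    (hCg : ∀ x, |g x| ≤ Cg) (μ₀ : Measure Ω) [IsProbabilityMeasure μ₀] (u v : ℝ)
    {Ω' : Type*} [MeasurableSpace Ω'] {P' : Measure Ω'} [IsProbabilityMeasure P'] {Y : Ω' → ℝ}
    (hY : HasLaw Y (gaussianReal 0 (Real.toNNReal (u ^ 2 * ((∫ y, (f y - ∫ z, f z ∂π) ^ 2 ∂π)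
            + 2 * ∑' k, ∫ y, (f y - ∫ z, f z ∂π) * (kop κ)^[k + 1] (fun y => f y - ∫ z, f z ∂π) y ∂π)
          + 2 * (u * v) * ((∫ y, (f y - ∫ z, f z ∂π) * (g y - ∫ z, g z ∂π) ∂π)
            + ∑' k, ((∫ y, (f y - ∫ z, f z ∂π) * (kop κ)^[k + 1] (fun y => g y - ∫ z, g z ∂π) y ∂π)
              + ∫ y, (g y - ∫ z, g z ∂π) * (kop κ)^[k + 1] (fun y => f y - ∫ z, f z ∂π) y ∂π))
          + v ^ 2 * ((∫ y, (g y - ∫ z, g z ∂π) ^ 2 ∂π)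
            + 2 * ∑' k, ∫ y, (g y - ∫ z, g z ∂π) * (kop κ)^[k + 1] (fun y => g y - ∫ z, g z ∂π) y ∂π)))) P')
    [IsProbabilityMeasure (Kernel.trajMeasure (X := fun _ : ℕ => Ω) μ₀
          (fun n : ℕ => κ.comap (fun h : (i : ↥(Finset.Iic n)) → Ω => h ⟨n, Finset.mem_Iic.2 le_rfl⟩)
            (measurable_pi_apply _)))] :
    TendstoInDistribution (fun (n : ℕ) (x : ℕ → Ω) =>
        (Real.sqrt n)⁻¹ * ∑ t ∈ Finset.range n,
          (u * (f (x t) - ∫ z, f z ∂π) + v * (g (x t) - ∫ z, g z ∂π)))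
      atTop Y (fun _ => (Kernel.trajMeasure (X := fun _ : ℕ => Ω) μ₀
          (fun n : ℕ => κ.comap (fun h : (i : ↥(Finset.Iic n)) → Ω => h ⟨n, Finset.mem_Iic.2 le_rfl⟩)
            (measurable_pi_apply _)))) P' := by
  obtain ⟨A, ρ, -, hρ0, hρ1, henv⟩ := exists_geometricEnvelope_of_nHit
    (Exactness.GeneralNCMC.minorised_setwise hmin) hε0 hε1 hm hπ
  rw [← greenKubo_lincomb_eq_of_envelope henv hρ0 hρ1 hf hg hCf hCg u v] at hY
  have hm' : Measurable fun y => u * f y + v * g y := (hf.const_mul u).add (hg.const_mul v)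
  have hb' : ∀ y, |u * f y + v * g y| ≤ |u| * Cf + |v| * Cg := fun y => by
    refine (abs_add_le _ _).trans (add_le_add ?_ ?_)
    · rw [abs_mul]; exact mul_le_mul_of_nonneg_left (hCf y) (abs_nonneg u)
    · rw [abs_mul]; exact mul_le_mul_of_nonneg_left (hCg y) (abs_nonneg v)
  have hclt := Exactness.GeneralNCMC.tendstoInDistribution_timeAverage_of_nHit hπ hε0.ne' hmin hm
    hm' hb' μ₀ hY
  have hch : ∫ z, (u * f z + v * g z) ∂π = u * ∫ z, f z ∂π + v * ∫ z, g z ∂π := by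
    rw [integral_add ((integrable_of_bounded π hf hCf).const_mul u)
      ((integrable_of_bounded π hg hCg).const_mul v), integral_const_mul, integral_const_mul]
  refine hclt.congr (fun n => Eventually.of_forall fun x => ?_) EventuallyEq.rfl
  show (Real.sqrt n)⁻¹ * ∑ t ∈ Finset.range n, ((u * f (x t) + v * g (x t))
      - ∫ z, (u * f z + v * g z) ∂π)
    = (Real.sqrt n)⁻¹ * ∑ t ∈ Finset.range n,
      (u * (f (x t) - ∫ z, f z ∂π) + v * (g (x t) - ∫ z, g z ∂π))
  rw [hch]
  exact congrArg _ (Finset.sum_congr rfl fun t _ => by ring)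

end Lincomb

/-! ### The joint CLT by Cramér–Wold -/

section Joint

/-- **THE BIVARIATE MARKOV-CHAIN CLT, FROM ANY INITIAL LAW.**  Same hypotheses; let `Z₁, Z₂` be
a.e.-measurable on a probability space with `u Z₁ + v Z₂ ~ N(0, u² σ²_f + 2uv σ_{fg} + v² σ²_g)` for
all reals `u, v`.  Then `((√n)⁻¹ Σ_{t<n} (f(x_t) − πf), (√n)⁻¹ Σ_{t<n} (g(x_t) − πg)) ⇒ (Z₁, Z₂)` in
`ℝ × ℝ` under `P_{μ₀}`. -/
theorem chain_bivariate_clt_of_nHit {π : Measure Ω} [IsProbabilityMeasure π]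
    (hπ : Kernel.Invariant κ π) (hmin : ∀ z, ε • ν ≤ Exactness.nHit κ m z) (hε0 : 0 < ε)
    (hε1 : ε ≤ 1) (hm : 0 < m)
    {f g : Ω → ℝ} (hf : Measurable f) (hg : Measurable g) {Cf Cg : ℝ} (hCf : ∀ x, |f x| ≤ Cf)
    (hCg : ∀ x, |g x| ≤ Cg) (μ₀ : Measure Ω) [IsProbabilityMeasure μ₀]
    {Ω' : Type*} [MeasurableSpace Ω'] {P' : Measure Ω'} [IsProbabilityMeasure P'] {Z₁ Z₂ : Ω' → ℝ}
    (hZ₁ : AEMeasurable Z₁ P') (hZ₂ : AEMeasurable Z₂ P')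
    (hZ : ∀ u v : ℝ, HasLaw (fun ω => u * Z₁ ω + v * Z₂ ω) (gaussianReal 0 (Real.toNNReal
        (u ^ 2 * ((∫ y, (f y - ∫ z, f z ∂π) ^ 2 ∂π)
            + 2 * ∑' k, ∫ y, (f y - ∫ z, f z ∂π) * (kop κ)^[k + 1] (fun y => f y - ∫ z, f z ∂π) y ∂π)
          + 2 * (u * v) * ((∫ y, (f y - ∫ z, f z ∂π) * (g y - ∫ z, g z ∂π) ∂π)
            + ∑' k, ((∫ y, (f y - ∫ z, f z ∂π) * (kop κ)^[k + 1] (fun y => g y - ∫ z, g z ∂π) y ∂π)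
              + ∫ y, (g y - ∫ z, g z ∂π) * (kop κ)^[k + 1] (fun y => f y - ∫ z, f z ∂π) y ∂π))
          + v ^ 2 * ((∫ y, (g y - ∫ z, g z ∂π) ^ 2 ∂π)
            + 2 * ∑' k, ∫ y, (g y - ∫ z, g z ∂π) * (kop κ)^[k + 1] (fun y => g y - ∫ z, g z ∂π) y ∂π)))) P')
    [IsProbabilityMeasure (Kernel.trajMeasure (X := fun _ : ℕ => Ω) μ₀
          (fun n : ℕ => κ.comap (fun h : (i : ↥(Finset.Iic n)) → Ω => h ⟨n, Finset.mem_Iic.2 le_rfl⟩)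
            (measurable_pi_apply _)))] :
    TendstoInDistribution (fun (n : ℕ) (x : ℕ → Ω) =>
        ((Real.sqrt n)⁻¹ * ∑ t ∈ Finset.range n, (f (x t) - ∫ z, f z ∂π),
          (Real.sqrt n)⁻¹ * ∑ t ∈ Finset.range n, (g (x t) - ∫ z, g z ∂π)))
      atTop (fun ω => (Z₁ ω, Z₂ ω)) (fun _ => (Kernel.trajMeasure (X := fun _ : ℕ => Ω) μ₀
          (fun n : ℕ => κ.comap (fun h : (i : ↥(Finset.Iic n)) → Ω => h ⟨n, Finset.mem_Iic.2 le_rfl⟩)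
            (measurable_pi_apply _)))) P' := by
  set P := (Kernel.trajMeasure (X := fun _ : ℕ => Ω) μ₀
          (fun n : ℕ => κ.comap (fun h : (i : ↥(Finset.Iic n)) → Ω => h ⟨n, Finset.mem_Iic.2 le_rfl⟩)
            (measurable_pi_apply _))) with hP
  obtain ⟨hfb, -, -⟩ := centred_observable_bounds π hf hCf
  obtain ⟨hgb, -, -⟩ := centred_observable_bounds π hg hCg
  have hXm : ∀ n : ℕ, Measurable fun x : ℕ → Ω =>
      (Real.sqrt n)⁻¹ * ∑ t ∈ Finset.range n, (f (x t) - ∫ z, f z ∂π) := fun n =>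
    measurable_const.mul (Finset.measurable_sum _ fun t _ => hfb.comp (measurable_pi_apply t))
  have hYm : ∀ n : ℕ, Measurable fun x : ℕ → Ω =>
      (Real.sqrt n)⁻¹ * ∑ t ∈ Finset.range n, (g (x t) - ∫ z, g z ∂π) := fun n =>
    measurable_const.mul (Finset.measurable_sum _ fun t _ => hgb.comp (measurable_pi_apply t))
  -- the pair, read in the inner product space `WithLp 2 (ℝ × ℝ)`
  have hVm : ∀ n : ℕ, AEMeasurable (fun x : ℕ → Ω => toLp 2
      ((Real.sqrt n)⁻¹ * ∑ t ∈ Finset.range n, (f (x t) - ∫ z, f z ∂π),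
        (Real.sqrt n)⁻¹ * ∑ t ∈ Finset.range n, (g (x t) - ∫ z, g z ∂π))) P := fun n =>
    ((measurable_toLp 2 (ℝ × ℝ)).comp ((hXm n).prodMk (hYm n))).aemeasurable
  have hVZ : AEMeasurable (fun ω' => toLp 2 (Z₁ ω', Z₂ ω')) P' :=
    (measurable_toLp 2 (ℝ × ℝ)).comp_aemeasurable (hZ₁.prodMk hZ₂)
  have hV : TendstoInDistribution (fun (n : ℕ) (x : ℕ → Ω) => toLp 2
      ((Real.sqrt n)⁻¹ * ∑ t ∈ Finset.range n, (f (x t) - ∫ z, f z ∂π),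
        (Real.sqrt n)⁻¹ * ∑ t ∈ Finset.range n, (g (x t) - ∫ z, g z ∂π)))
      atTop (fun ω' => toLp 2 (Z₁ ω', Z₂ ω')) (fun _ => P) P' := by
    refine CardConsistency.tendstoInDistribution_of_forall_inner (P := fun _ => P) hVm hVZ
      fun t => ?_
    have h := chain_lincomb_clt_of_nHit hπ hmin hε0 hε1 hm hf hg hCf hCg μ₀ (ofLp t).1 (ofLp t).2
      (hZ (ofLp t).1 (ofLp t).2)
    refine h.congr (fun n => Eventually.of_forall fun x => ?_) (Eventually.of_forall fun ω' => ?_)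
    · show (Real.sqrt n)⁻¹ * ∑ t' ∈ Finset.range n,
          ((ofLp t).1 * (f (x t') - ∫ z, f z ∂π) + (ofLp t).2 * (g (x t') - ∫ z, g z ∂π))
        = ⟪t, toLp 2 ((Real.sqrt n)⁻¹ * ∑ t' ∈ Finset.range n, (f (x t') - ∫ z, f z ∂π),
            (Real.sqrt n)⁻¹ * ∑ t' ∈ Finset.range n, (g (x t') - ∫ z, g z ∂π))⟫
      rw [CardConsistency.inner_toLp_prod, Finset.sum_add_distrib, ← Finset.mul_sum,
        ← Finset.mul_sum]
      ring
    · exact (CardConsistency.inner_toLp_prod t _ _).symm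
  -- back to `ℝ × ℝ`
  exact hV.continuous_comp (prod_continuous_ofLp 2 ℝ ℝ)

/-- **THE BIVARIATE CLT IS NOT VACUOUS: THE GAUSSIAN PAIR EXISTS.**  Same hypotheses on the
chain; there are measurable `Z₁, Z₂` on `(ℝ × ℝ, N(0,1) ⊗ N(0,1))` with
`u Z₁ + v Z₂ ~ N(0, u² σ²_f + 2uv σ_{fg} + v² σ²_g)` for all `u, v`, and for them the pair of scaled
centred sums converges in distribution to `(Z₁, Z₂)` from every initial law. -/
theorem chain_bivariate_clt_exists_of_nHit {π : Measure Ω} [IsProbabilityMeasure π]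
    (hπ : Kernel.Invariant κ π) (hmin : ∀ z, ε • ν ≤ Exactness.nHit κ m z) (hε0 : 0 < ε)
    (hε1 : ε ≤ 1) (hm : 0 < m)
    {f g : Ω → ℝ} (hf : Measurable f) (hg : Measurable g) {Cf Cg : ℝ} (hCf : ∀ x, |f x| ≤ Cf)
    (hCg : ∀ x, |g x| ≤ Cg) (μ₀ : Measure Ω) [IsProbabilityMeasure μ₀]
    [IsProbabilityMeasure (Kernel.trajMeasure (X := fun _ : ℕ => Ω) μ₀
          (fun n : ℕ => κ.comap (fun h : (i : ↥(Finset.Iic n)) → Ω => h ⟨n, Finset.mem_Iic.2 le_rfl⟩)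
            (measurable_pi_apply _)))] :
    ∃ Z₁ Z₂ : ℝ × ℝ → ℝ, Measurable Z₁ ∧ Measurable Z₂ ∧
      (∀ u v : ℝ, HasLaw (fun ω => u * Z₁ ω + v * Z₂ ω) (gaussianReal 0 (Real.toNNReal
        (u ^ 2 * ((∫ y, (f y - ∫ z, f z ∂π) ^ 2 ∂π)
            + 2 * ∑' k, ∫ y, (f y - ∫ z, f z ∂π) * (kop κ)^[k + 1] (fun y => f y - ∫ z, f z ∂π) y ∂π)
          + 2 * (u * v) * ((∫ y, (f y - ∫ z, f z ∂π) * (g y - ∫ z, g z ∂π) ∂π)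
            + ∑' k, ((∫ y, (f y - ∫ z, f z ∂π) * (kop κ)^[k + 1] (fun y => g y - ∫ z, g z ∂π) y ∂π)
              + ∫ y, (g y - ∫ z, g z ∂π) * (kop κ)^[k + 1] (fun y => f y - ∫ z, f z ∂π) y ∂π))
          + v ^ 2 * ((∫ y, (g y - ∫ z, g z ∂π) ^ 2 ∂π)
            + 2 * ∑' k, ∫ y, (g y - ∫ z, g z ∂π) * (kop κ)^[k + 1] (fun y => g y - ∫ z, g z ∂π) y ∂π)))) ((gaussianReal 0 1).prod (gaussianReal 0 1))) ∧
      TendstoInDistribution (fun (n : ℕ) (x : ℕ → Ω) =>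
          ((Real.sqrt n)⁻¹ * ∑ t ∈ Finset.range n, (f (x t) - ∫ z, f z ∂π),
            (Real.sqrt n)⁻¹ * ∑ t ∈ Finset.range n, (g (x t) - ∫ z, g z ∂π)))
        atTop (fun ω => (Z₁ ω, Z₂ ω)) (fun _ => (Kernel.trajMeasure (X := fun _ : ℕ => Ω) μ₀
          (fun n : ℕ => κ.comap (fun h : (i : ↥(Finset.Iic n)) → Ω => h ⟨n, Finset.mem_Iic.2 le_rfl⟩)
            (measurable_pi_apply _))))
        ((gaussianReal 0 1).prod (gaussianReal 0 1)) := by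
  have hmin' := Exactness.GeneralNCMC.minorised_setwise hmin
  obtain ⟨A, ρ, -, hρ0, hρ1, henv⟩ := exists_geometricEnvelope_of_nHit hmin' hε0 hε1 hm hπ
  have h₁ := greenKubo_nonneg_of_envelope hπ henv hρ0 hρ1 hf hCf
  have h₂ := greenKubo_nonneg_of_envelope hπ henv hρ0 hρ1 hg hCg
  have hc := greenKuboCross_sq_le_of_envelope hπ henv hρ0 hρ1 hf hg hCf hCg
  obtain ⟨Z₁, Z₂, hZ₁, hZ₂, hZ⟩ := exists_gaussianPair h₁ h₂ hc
  exact ⟨Z₁, Z₂, hZ₁, hZ₂, hZ, chain_bivariate_clt_of_nHit hπ hmin hε0 hε1 hm hf hg hCf hCg μ₀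
    hZ₁.aemeasurable hZ₂.aemeasurable hZ⟩

end Joint

end Summit.Ventures.LatticeQCDFlow.Scoring

end
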